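import Mathlib
import Summits.Ventures.HodgeRepro.Tier4.Common.AdelicDefs
import Summits.Ventures.HodgeRepro.Tier4.Common.AdelicPlaces
import Summits.Ventures.HodgeRepro.Tier4.Common.AdelicHaar
import Summits.Ventures.HodgeRepro.Tier4.Common.LocalTorus
import Summits.Ventures.HodgeRepro.Tier4.Common.CongruenceAdeles

/-!
# Tier4/Common/CompactOpenLevel — the principal congruence subgroups `K(N) ≤ G(𝔸_f)` of the adelic unitary group:
compact open in the finite part (t4-plan-1's WANTED-COMMON S13521 (2) / t4-L1-p3 S13483 (c), group side)

Blind re-derivation cell `pub-hodge-repro`, Tier 4 (README §9–§10), seat t4-typer-2 (gen 2).  Target tree path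
`lean/Summits/Ventures/HodgeRepro/Tier4/Common/CompactOpenLevel.lean`.  Imports `AdelicDefs` (`GA`, `GL4`, `M4`,
`GA.mat`), `AdelicPlaces` (`GA.infiniteComponent`), `AdelicHaar` (`isClosed_unitaryGroup`, `t2Space_M4`), `LocalTorus`
(`finitePart`, `IsCompactOpenIn`), `CongruenceAdeles` (`modSet`, open / closed / compact, `integralSet`).

**`IsCongr k N A`** — a `4 × 4` adelic matrix is `≡ 1 (mod N)`: its archimedean part is the identity and every entry
of its finite part lies in `δ_ij + ∏_v N·𝓞_v` (`modSet k N`).  The condition is closed under products (`IsCongr.mul`: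
`modSet` is an additive group and an ideal of the integral adeles), so **`levelGL k N ≤ GL₄(𝔸_k)`** = `{g | g ≡ 1 ∧ g⁻¹ ≡ 1
(mod N)}` is a subgroup, and **`levelK W N := (levelGL k N).subgroupOf (unitaryGroup W)`** is the principal congruence
subgroup of level `N` of `G(𝔸_k)`, a subgroup of `finitePart W` (`levelK_le_finitePart`).  PROVED:
**`isCompactOpenIn_levelK (hN : N ≠ 0) : IsCompactOpenIn W (finitePart W) (levelK W N)`** — open in the finite part
(the congruence conditions are preimages of the open `modSet k N` under continuous entry maps), compact (a closed
subset of the preimage, under the closed embedding `g ↦ (g, g⁻¹)` of `G(𝔸_k)` into `M₄ × M₄ᵐᵒᵖ`, of the compact set of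
pairs of integral matrices with identity archimedean part — Tychonoff on `isCompact_integralSet`).  The neighbourhood
basis statement `∀ V ∈ 𝓝 (1 : GA W), ∃ N, levelK W N ⊆ V` is the next append.

Nothing here says anything about the status of the Hodge conjecture for CM abelian varieties, which is NOT proved
(HC_CM is NOT proved by anyone in this repository).
-/

set_option autoImplicit false

noncomputable section

namespace Summit.Ventures.HodgeRepro.Tier4.Common

open NumberField IsDedekindDomain Topology Filter Set Matrix
open scoped NumberField

section ModSetAlgebra

variable (k : Type) [Field k] [NumberField k]

/-- `0 ∈ modSet k N`. -/
theorem zero_mem_modSet (N : ℕ) : (0 : FiniteAdeleRing (𝓞 k) k) ∈ modSet k N := by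
  intro v
  show Valued.v (0 : v.adicCompletion k) ≤ _
  rw [Valuation.map_zero]
  exact zero_le

/-- `modSet k N` is closed under addition (ultrametric). -/
theorem add_mem_modSet {N : ℕ} {x y : FiniteAdeleRing (𝓞 k) k} (hx : x ∈ modSet k N) (hy : y ∈ modSet k N) :
    x + y ∈ modSet k N := by
  intro v
  show Valued.v (x v + y v) ≤ _
  exact (Valuation.map_add _ _ _).trans (max_le (hx v) (hy v))

/-- `modSet k N` is closed under negation. -/
theorem neg_mem_modSet {N : ℕ} {x : FiniteAdeleRing (𝓞 k) k} (hx : x ∈ modSet k N) : -x ∈ modSet k N := by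
  intro v
  show Valued.v (-(x v)) ≤ _
  rw [Valuation.map_neg]
  exact hx v

/-- `modSet k N` is closed under multiplication (`|N|_v ≤ 1`). -/
theorem mul_mem_modSet {N : ℕ} {x y : FiniteAdeleRing (𝓞 k) k} (hx : x ∈ modSet k N) (hy : y ∈ modSet k N) :
    x * y ∈ modSet k N := by
  intro v
  show Valued.v (x v * y v) ≤ _
  rw [Valuation.map_mul]
  calc Valued.v (x v) * Valued.v (y v) ≤ natSize k v N * natSize k v N :=
        mul_le_mul' (hx v) (hy v)
    _ ≤ natSize k v N * 1 := mul_le_mul_right (natSize_le_one k v N) _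
    _ = natSize k v N := mul_one _

/-- Finite sums of elements of `modSet k N` lie in `modSet k N`. -/
theorem sum_mem_modSet {N : ℕ} {ι : Type} (s : Finset ι) {f : ι → FiniteAdeleRing (𝓞 k) k}
    (hf : ∀ i ∈ s, f i ∈ modSet k N) : ∑ i ∈ s, f i ∈ modSet k N := by
  classical
  induction s using Finset.induction_on with
  | empty => simpa using zero_mem_modSet k N
  | insert a s ha ih =>
    rw [Finset.sum_insert ha]
    exact add_mem_modSet k (hf a (Finset.mem_insert_self a s))
      (ih fun i hi => hf i (Finset.mem_insert_of_mem hi))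

end ModSetAlgebra

section Congruence

variable (k : Type) [Field k] [NumberField k]

/-- The archimedean part of an adele, as a ring homomorphism `𝔸_k →+* 𝔸_{k,∞}`. -/
def infPart : Ad k →+* InfiniteAdeleRing k := RingHom.fst (InfiniteAdeleRing k) (FiniteAdeleRing (𝓞 k) k)

/-- The finite part of an adele, as a ring homomorphism `𝔸_k →+* 𝔸_{k,f}`. -/
def finPart : Ad k →+* FiniteAdeleRing (𝓞 k) k := RingHom.snd (InfiniteAdeleRing k) (FiniteAdeleRing (𝓞 k) k)

/-- **The congruence entries mod `N`**: the adeles with archimedean part `0` and finite part in `∏_v N·𝓞_v` — an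
additive subgroup of `𝔸_k` closed under multiplication. -/
def congrSet (N : ℕ) : AddSubgroup (Ad k) where
  carrier := {x | infPart k x = 0 ∧ finPart k x ∈ modSet k N}
  zero_mem' := ⟨map_zero _, by rw [map_zero]; exact zero_mem_modSet k N⟩
  add_mem' := by
    rintro x y ⟨hx1, hx2⟩ ⟨hy1, hy2⟩
    exact ⟨by rw [map_add, hx1, hy1, add_zero], by rw [map_add]; exact add_mem_modSet k hx2 hy2⟩
  neg_mem' := by
    rintro x ⟨hx1, hx2⟩
    exact ⟨by rw [map_neg, hx1, neg_zero], by rw [map_neg]; exact neg_mem_modSet k hx2⟩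

/-- `congrSet` is closed under multiplication. -/
theorem congrSet_mul_mem {N : ℕ} {x y : Ad k} (hx : x ∈ congrSet k N) (hy : y ∈ congrSet k N) :
    x * y ∈ congrSet k N :=
  ⟨by rw [map_mul, hx.1, zero_mul], by rw [map_mul]; exact mul_mem_modSet k hx.2 hy.2⟩

/-- **`A ≡ 1 (mod N)`** for an adelic `4 × 4` matrix: every entry of `A − 1` is a congruence entry. -/
def IsCongr (N : ℕ) (A : M4 k) : Prop := ∀ i j, (A - 1) i j ∈ congrSet k N

/-- `1 ≡ 1`. -/
theorem IsCongr.one (N : ℕ) : IsCongr k N (1 : M4 k) := fun i j => by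
  rw [sub_self]
  exact (congrSet k N).zero_mem

/-- The congruence condition is closed under products: `A B − 1 = (A − 1)(B − 1) + (A − 1) + (B − 1)`. -/
theorem IsCongr.mul {N : ℕ} {A B : M4 k} (hA : IsCongr k N A) (hB : IsCongr k N B) : IsCongr k N (A * B) := by
  intro i j
  have hprod : ∀ i j, ((A - 1) * (B - 1)) i j ∈ congrSet k N := by
    intro i j
    rw [Matrix.mul_apply]
    exact (congrSet k N).sum_mem fun x _ => congrSet_mul_mem k (hA i x) (hB x j)
  have hid : A * B - 1 = (A - 1) * (B - 1) + (A - 1) + (B - 1) := by noncomm_ring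
  rw [hid, Matrix.add_apply, Matrix.add_apply]
  exact (congrSet k N).add_mem ((congrSet k N).add_mem (hprod i j) (hA i j)) (hB i j)

/-- **The principal congruence subgroup of level `N` of `GL₄(𝔸_k)`**: `g ≡ 1` and `g⁻¹ ≡ 1 (mod N)`. -/
def levelGL (N : ℕ) : Subgroup (GL4 k) where
  carrier := {g | IsCongr k N (g : M4 k) ∧ IsCongr k N ((g⁻¹ : GL4 k) : M4 k)}
  one_mem' := ⟨IsCongr.one k N, by simpa using IsCongr.one k N⟩
  mul_mem' := by
    rintro g h ⟨hg, hg'⟩ ⟨hh, hh'⟩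
    refine ⟨?_, ?_⟩
    · rw [Units.val_mul]; exact hg.mul k hh
    · rw [_root_.mul_inv_rev, Units.val_mul]; exact hh'.mul k hg'
  inv_mem' := by
    rintro g ⟨hg, hg'⟩
    exact ⟨hg', by rw [inv_inv]; exact hg⟩

end Congruence

section Level

variable {k : Type} [Field k] [NumberField k] (W : PlaneData k)

/-- **`K(N) ≤ G(𝔸_k)`**: the principal congruence subgroup of level `N` of the adelic unitary group. -/
def levelK (N : ℕ) : Subgroup (GA W) := (levelGL k N).subgroupOf (unitaryGroup W)

/-- Membership in `K(N)`. -/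
theorem mem_levelK (N : ℕ) (g : GA W) :
    g ∈ levelK W N ↔ IsCongr k N (GA.mat W g) ∧ IsCongr k N (GA.mat W g⁻¹) := by
  show (g : GL4 k) ∈ levelGL k N ↔ _
  rfl

/-- The archimedean components of an entry of a matrix `≡ 1 (mod N)` are those of the identity, so its
`w`-component is the identity matrix: `K(N) ≤ G(𝔸_f)`. -/
theorem levelK_le_finitePart (N : ℕ) : levelK W N ≤ finitePart W := by
  intro g hg w
  obtain ⟨hg1, -⟩ := (mem_levelK W N g).1 hg
  apply Units.ext
  apply Matrix.ext
  intro i j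
  have h1 : ((GA.infiniteComponent W w g : GL (Fin 4) w.Completion) : Matrix (Fin 4) (Fin 4) w.Completion) i j =
      infPart k (GA.mat W g i j) w := rfl
  have h2 : infPart k (GA.mat W g i j) = infPart k ((1 : M4 k) i j) := by
    have := (hg1 i j).1
    rw [Matrix.sub_apply, map_sub, sub_eq_zero] at this
    exact this
  rw [h1, h2, Units.val_one]
  by_cases hij : i = j
  · subst hij
    simp only [infPart, Matrix.one_apply_eq]
    rfl
  · simp only [infPart, Matrix.one_apply_ne hij]
    rfl

end Level

section CompactOpen

variable {k : Type} [Field k] [NumberField k] (W : PlaneData k)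

/-- `0 ∈ ∏_v 𝓞_v`. -/
theorem zero_mem_integralSet : (0 : FiniteAdeleRing (𝓞 k) k) ∈ integralSet k := fun v =>
  (v.adicCompletionIntegers k).zero_mem

/-- `1 ∈ ∏_v 𝓞_v`. -/
theorem one_mem_integralSet : (1 : FiniteAdeleRing (𝓞 k) k) ∈ integralSet k := fun v =>
  (v.adicCompletionIntegers k).one_mem

/-- `∏_v 𝓞_v` is closed under addition. -/
theorem add_mem_integralSet {x y : FiniteAdeleRing (𝓞 k) k} (hx : x ∈ integralSet k) (hy : y ∈ integralSet k) :
    x + y ∈ integralSet k := fun v => by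
  show (x + y) v ∈ _
  exact add_mem (hx v) (hy v)

/-- The finite part of an entry of `1` is integral. -/
theorem finPart_one_apply_mem (i j : Fin 4) : finPart k ((1 : M4 k) i j) ∈ integralSet k := by
  by_cases hij : i = j
  · subst hij; rw [Matrix.one_apply_eq, map_one]; exact one_mem_integralSet
  · rw [Matrix.one_apply_ne hij, map_zero]; exact zero_mem_integralSet

/-- The entry map `g ↦ (g − 1) i j` is continuous on `G(𝔸_k)`. -/
theorem continuous_entry_sub_one (i j : Fin 4) : Continuous fun g : GA W => (GA.mat W g - 1) i j := by
  have h : Continuous fun g : GA W => GA.mat W g := Units.continuous_val.comp continuous_subtype_val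
  exact (h.sub continuous_const).matrix_elem i j

/-- The entry map `g ↦ (g⁻¹ − 1) i j` is continuous on `G(𝔸_k)`. -/
theorem continuous_inv_entry_sub_one (i j : Fin 4) : Continuous fun g : GA W => (GA.mat W g⁻¹ - 1) i j := by
  have h : Continuous fun g : GA W => GA.mat W g⁻¹ := by
    have h1 : Continuous fun g : GA W => ((g : GL4 k)⁻¹ : GL4 k) :=
      continuous_inv.comp continuous_subtype_val
    exact Units.continuous_val.comp h1
  exact (h.sub continuous_const).matrix_elem i j

/-- `finPart` is continuous. -/
theorem continuous_finPart : Continuous (finPart k) := continuous_snd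

/-- `infPart` is continuous. -/
theorem continuous_infPart : Continuous (infPart k) := continuous_fst

/-- The finite-part congruence set: the conditions of `K(N)` on the finite parts only. -/
def finCongr (N : ℕ) : Set (GA W) :=
  {g | ∀ i j, finPart k ((GA.mat W g - 1) i j) ∈ modSet k N ∧ finPart k ((GA.mat W g⁻¹ - 1) i j) ∈ modSet k N}

/-- `finCongr N` is open in `G(𝔸_k)` (`N ≠ 0`). -/
theorem isOpen_finCongr {N : ℕ} (hN : N ≠ 0) : IsOpen (finCongr W N) := by
  have h : finCongr W N = ⋂ i, ⋂ j,
      ((fun g : GA W => finPart k ((GA.mat W g - 1) i j)) ⁻¹' modSet k N ∩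
        (fun g : GA W => finPart k ((GA.mat W g⁻¹ - 1) i j)) ⁻¹' modSet k N) := by
    ext g
    simp only [finCongr, Set.mem_setOf_eq, Set.mem_iInter, Set.mem_inter_iff, Set.mem_preimage]
  rw [h]
  refine isOpen_iInter_of_finite fun i => isOpen_iInter_of_finite fun j => IsOpen.inter ?_ ?_
  · exact (isOpen_modSet k hN).preimage (continuous_finPart.comp (continuous_entry_sub_one W i j))
  · exact (isOpen_modSet k hN).preimage (continuous_finPart.comp (continuous_inv_entry_sub_one W i j))

/-- On the finite part, the archimedean conditions of `K(N)` hold automatically: an element of `finitePart W` has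
`infPart ((g − 1) i j) = 0`. -/
theorem infPart_entry_sub_one_eq_zero {g : GA W} (hg : g ∈ finitePart W) (i j : Fin 4) :
    infPart k ((GA.mat W g - 1) i j) = 0 := by
  rw [Matrix.sub_apply, map_sub, sub_eq_zero]
  funext w
  have h1 : infPart k (GA.mat W g i j) w =
      ((GA.infiniteComponent W w g : GL (Fin 4) w.Completion) : Matrix (Fin 4) (Fin 4) w.Completion) i j := rfl
  rw [h1, hg w, Units.val_one]
  by_cases hij : i = j
  · subst hij
    simp only [infPart, Matrix.one_apply_eq]
    rfl
  · simp only [infPart, Matrix.one_apply_ne hij]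
    rfl

/-- On the finite part, `K(N)` is the trace of `finCongr N`. -/
theorem preimage_levelK_eq (N : ℕ) :
    (Subtype.val : finitePart W → GA W) ⁻¹' (levelK W N : Set (GA W)) = Subtype.val ⁻¹' finCongr W N := by
  ext ⟨g, hg⟩
  simp only [Set.mem_preimage, SetLike.mem_coe]
  rw [mem_levelK]
  constructor
  · rintro ⟨h1, h2⟩ i j
    exact ⟨(h1 i j).2, (h2 i j).2⟩
  · intro h
    refine ⟨fun i j => ⟨infPart_entry_sub_one_eq_zero W hg i j, (h i j).1⟩,
      fun i j => ⟨infPart_entry_sub_one_eq_zero W ((finitePart W).inv_mem hg) i j, (h i j).2⟩⟩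

/-- The closed embedding `g ↦ (g, g⁻¹)` of `G(𝔸_k)` into `M₄(𝔸_k) × M₄(𝔸_k)ᵐᵒᵖ`. -/
theorem isClosedEmbedding_embed :
    Topology.IsClosedEmbedding fun g : GA W => Units.embedProduct (M4 k) (g : GL4 k) := by
  haveI := t2Space_M4 k
  exact (Units.isClosedEmbedding_embedProduct (α := M4 k)).comp
    (isClosed_unitaryGroup W).isClosedEmbedding_subtypeVal

/-- The integral matrices with identity archimedean part (as a set of `M₄(𝔸_k)`). -/
def integralBox : Set (M4 k) :=
  Set.pi Set.univ fun i => Set.pi Set.univ fun j =>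
    (({infPart k ((1 : M4 k) i j)} : Set (InfiniteAdeleRing k)) ×ˢ integralSet k : Set (Ad k))

/-- `integralBox` is compact (Tychonoff). -/
theorem isCompact_integralBox : IsCompact (integralBox (k := k)) := by
  refine isCompact_univ_pi fun i => isCompact_univ_pi fun j => ?_
  exact isCompact_singleton.prod (isCompact_integralSet k)

/-- An entry `x` with `infPart x = infPart (1 i j)` and integral finite part lies in the box factor. -/
theorem mem_boxFactor {i j : Fin 4} {x : Ad k} (h1 : infPart k x = infPart k ((1 : M4 k) i j))
    (h2 : finPart k x ∈ integralSet k) :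
    x ∈ (({infPart k ((1 : M4 k) i j)} : Set (InfiniteAdeleRing k)) ×ˢ integralSet k : Set (Ad k)) :=
  ⟨h1, h2⟩

/-- A matrix `≡ 1 (mod N)` lies in the box. -/
theorem mem_integralBox_of_isCongr {N : ℕ} {A : M4 k} (hA : IsCongr k N A) : A ∈ integralBox := by
  refine Set.mem_univ_pi.2 fun i => Set.mem_univ_pi.2 fun j => mem_boxFactor ?_ ?_
  · have := (hA i j).1
    rw [Matrix.sub_apply, map_sub, sub_eq_zero] at this
    exact this
  · have h := (hA i j).2
    have hA' : finPart k (A i j) = finPart k ((A - 1) i j) + finPart k ((1 : M4 k) i j) := by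
      rw [Matrix.sub_apply, map_sub, sub_add_cancel]
    rw [hA']
    exact add_mem_integralSet (modSet_subset_integral k N h) (finPart_one_apply_mem i j)

/-- `K(N)` is closed in `G(𝔸_k)` (`N ≠ 0`). -/
theorem isClosed_levelK {N : ℕ} (hN : N ≠ 0) : IsClosed (levelK W N : Set (GA W)) := by
  have h : (levelK W N : Set (GA W)) = ⋂ i, ⋂ j,
      (((fun g : GA W => infPart k ((GA.mat W g - 1) i j)) ⁻¹' {0} ∩
        (fun g : GA W => finPart k ((GA.mat W g - 1) i j)) ⁻¹' modSet k N) ∩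
       ((fun g : GA W => infPart k ((GA.mat W g⁻¹ - 1) i j)) ⁻¹' {0} ∩
        (fun g : GA W => finPart k ((GA.mat W g⁻¹ - 1) i j)) ⁻¹' modSet k N)) := by
    ext g
    simp only [SetLike.mem_coe, mem_levelK, Set.mem_iInter, Set.mem_inter_iff, Set.mem_preimage,
      Set.mem_singleton_iff]
    constructor
    · rintro ⟨h1, h2⟩ i j
      exact ⟨⟨(h1 i j).1, (h1 i j).2⟩, ⟨(h2 i j).1, (h2 i j).2⟩⟩
    · intro h
      exact ⟨fun i j => ⟨(h i j).1.1, (h i j).1.2⟩, fun i j => ⟨(h i j).2.1, (h i j).2.2⟩⟩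
  rw [h]
  haveI : T2Space (InfiniteAdeleRing k) := inferInstanceAs (T2Space ((v : InfinitePlace k) → v.Completion))
  refine isClosed_iInter fun i => isClosed_iInter fun j => IsClosed.inter (IsClosed.inter ?_ ?_) (IsClosed.inter ?_ ?_)
  · exact isClosed_singleton.preimage (continuous_infPart.comp (continuous_entry_sub_one W i j))
  · exact (isClosed_modSet k hN).preimage (continuous_finPart.comp (continuous_entry_sub_one W i j))
  · exact isClosed_singleton.preimage (continuous_infPart.comp (continuous_inv_entry_sub_one W i j))
  · exact (isClosed_modSet k hN).preimage (continuous_finPart.comp (continuous_inv_entry_sub_one W i j))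

/-- **`K(N)` is compact** (`N ≠ 0`): a closed subset of the preimage, under the closed embedding `g ↦ (g, g⁻¹)`, of
the compact set of pairs of integral matrices with identity archimedean part. -/
theorem isCompact_levelK {N : ℕ} (hN : N ≠ 0) : IsCompact (levelK W N : Set (GA W)) := by
  have hP : IsCompact ((integralBox (k := k)) ×ˢ (MulOpposite.op '' integralBox (k := k))) :=
    isCompact_integralBox.prod (isCompact_integralBox.image MulOpposite.continuous_op)
  have hC : IsCompact ((fun g : GA W => Units.embedProduct (M4 k) (g : GL4 k)) ⁻¹'
      ((integralBox (k := k)) ×ˢ (MulOpposite.op '' integralBox (k := k)))) :=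
    (isClosedEmbedding_embed W).isCompact_preimage hP
  refine hC.of_isClosed_subset (isClosed_levelK W hN) ?_
  intro g hg
  obtain ⟨h1, h2⟩ := (mem_levelK W N g).1 hg
  show Units.embedProduct (M4 k) (g : GL4 k) ∈ (integralBox (k := k)) ×ˢ (MulOpposite.op '' integralBox (k := k))
  rw [Units.embedProduct_apply]
  refine ⟨mem_integralBox_of_isCongr h1, ?_⟩
  exact ⟨_, mem_integralBox_of_isCongr h2, rfl⟩

/-- **`K(N)` is a compact open subgroup of the finite part `G(𝔸_f)`** (`N ≠ 0`). -/
theorem isCompactOpenIn_levelK {N : ℕ} (hN : N ≠ 0) : IsCompactOpenIn W (finitePart W) (levelK W N) := by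
  refine ⟨levelK_le_finitePart W N, isCompact_levelK W hN, ?_⟩
  rw [preimage_levelK_eq]
  exact (isOpen_finCongr W hN).preimage continuous_subtype_val

end CompactOpen

end Summit.Ventures.HodgeRepro.Tier4.Common

end
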